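import Literature.NumberTheory.Automorphic.ShimuraCurveRibetTakahashiCokernelProofs
import Literature.NumberTheory.EllipticCurves.PastenHeightBoundsLemma68LocalProofs
import Literature.NumberTheory.EllipticCurves.OpenImageMazurProofs
import HarnessLib

/-!
# Pasten 2024 §6 EXACTLY at a prime `ℓ` with `E[ℓ]` irreducible: Lemma 6.8 without slack, exact
# switching (Lemma 6.15 with `α(ℓ) = 0`), and the telescoping of §6.9 along a witness prime

`Proofs` file (THEOREMS ONLY — no definition, no named fact, no instance) continuing
`ShimuraCurveRibetTakahashiCokernelProofs.lean` (H. Pasten, *Shimura curves and the abc conjecture*,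
J. Number Theory 254 (2024) = arXiv:1705.09251, §6: Prop. 6.13 p. 23 = Ribet–Takahashi 1997 Thm. 2;
Lemma 6.8 p. 22; Lemmas 6.14–6.15 pp. 23–24; Lemma 6.18 p. 25; the telescoping of §6.9 p. 25).

The cokernel file performs §6 with the PRINTED slack: Lemma 6.8 as a height bound `≤ 163`
(Mazur–Kenku), Lemma 6.14 as `i_p ∣ κ_S`, hence `|v_ℓ(j_p) − v_ℓ(j_r)| ≤ α_S(ℓ)` and a denominator of
`γ_{D,M,E}` dividing `κ^{ω(D)}`. This file records the observation (used summit-side for the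
Ribet–Takahashi exactness at `ℓ = 3` of the BSD rank-1 residual cell, class O6, node R5a) that AT A
PRIME `ℓ` WITH `E[ℓ]` IRREDUCIBLE every slack term vanishes:

* §1 **Lemma 6.8 is EXACT at `ℓ`** — a theorem, with neither the height bound nor Mazur–Kenku:
  `ℚ`-isogenous curves are joined by a cyclic isogeny (`IsIsogenous.exists_isCyclic`, *AEC* III.4.11),
  whose degree is prime to `ℓ` when `E[ℓ]` is irreducible
  (`not_dvd_degree_of_isCyclic_of_hasIrreducibleModPGaloisRep`: otherwise `ker ∩ E[ℓ]` is a
  `Γ_ℚ`-stable line, `Mazur1978.not_hasIrreducibleModPGaloisRep_iff_exists_natCard_eq`), and along a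
  cyclic `n`-isogeny `c_v(W)/c_v(W') = a/b` with `ab ∣ n`
  (`exists_ordMinimalDiscriminant_mul_eq_mul_of_isCyclic`, the modular-equation proof of the local
  input of Lemma 6.8); so `v_ℓ c_p(A) = v_ℓ c_p(E)` for every `A` of the class and every `p ∥ N`
  (`factorization_factorization_minimalDiscriminantNorm_eq_of_isIsogenous`, factorization form as in
  `lemma_6_8_factorization_form`).
* §2 the flat exact switching identity (`factorization_eq_of_two_identities`; compare the slack form
  `factorization_le_of_two_identities`).
* §3 over the Ribet–Takahashi system (section variables `cI`, `cJ`, `h613`, `hJc`, `hEis` VERBATIM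
  as in the cokernel file, plus `h618` = Lemma 6.18 (Papikian–Rabinoff, `j_p(D,M) ∣ p − 1` for
  `p ∣ D`) and `hwit` = an irreducibility witness (`E[ℓ]` irreducible ⇒ arbitrarily large primes `r`
  with `ℓ ∤ r + 1 − a_r(E)`: Chebotarev + Brauer–Nesbitt, the per-curve `β = 1` case of the mechanism
  of Lemma 6.7)): `ℓ ∤ i_p(D,M)` for `p ∥ M` (`not_dvd_cI_of_witness`), `ℓ ∤ j_{q₀}(D,M)` at a WITNESS
  prime `q₀ ∣ D` — `q₀ ≢ 1 (mod ℓ)` or `ℓ ∤ c_{q₀}(E)` — (`not_dvd_cJ_of_witness`), and Lemma 6.15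
  EXACT: `v_ℓ j_p(D,M) = v_ℓ j_r(D,M)` for all `p, r ∣ D` (`factorization_cJ_eq_of_dvd_of_dvd`).
* §4 the exact two-prime step (`twoPrimeStep_coprime`) and the telescoping of §6.9 by induction on
  `ω(D)/2` KEEPING THE WITNESS PRIME IN `D` UNTIL THE LAST PAIR
  (`modularDegree_mul_eq_mul_coprime_of_witness`): under the `ℓ`-adic `D = 1` bridge `h0'` between the
  tree's two renderings of `δ_{1,N}` (the cokernel file's `h0` is the divisibility form),
  `δ_{1,N} · b = a · δ_{D,M} · ∏_{p∣D} v_p(Δ_E)` with `ℓ ∤ a b` whenever `D` has a witness prime —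
  i.e. `γ_{D,M,E}` is an `ℓ`-adic unit. Compare `denominator_dvd_pow_of_twoPrimeStep` /
  `PastenShimura2024_thm_6_1_b'` (same induction, bounded instead of exact).

Every printed input is a HYPOTHESIS binder, never a declaration of the tree (the idiom of
`PastenShimura2024_thm_6_1_b'`); nothing here is a new fact. Summit-side consumer:
`Summits/BirchSwinnertonDyer/Rank1Residual/Additive/WildThreeQuaternionicTransferKnownCase.lean`
(`AdditiveThree.QuaternionicTamagawaTransferAtThreeKnownCase`, `ℓ = 3`).
-/

set_option autoImplicit false

noncomputable section

open scoped Classical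

namespace Literature.NumberTheory.Automorphic

open Literature.NumberTheory.EllipticCurves (LFunction_eq_of_isIsogenous_holds)
open Literature.NumberTheory.EllipticCurves.ModularForms (ModularParametrizationData IsNewformOf
  exists_ordMinimalDiscriminant_mul_eq_mul_of_isCyclic hasMultiplicativeReductionAt_of_isIsogenous)
open WeierstrassCurve

/-! ## §1. Lemma 6.8 is EXACT at a prime `ℓ` with `E[ℓ]` irreducible -/

/-- **No cyclic `ℚ`-isogeny out of `W` has degree divisible by `ℓ` when `W[ℓ]` is irreducible.**
If `φ : W → W'` is cyclic with `ℓ ∣ deg φ`, then `ker φ ∩ W[ℓ]` is a `Γ_ℚ`-stable subgroup of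
`W[ℓ]` of order `ℓ` (`natCard_ker_inf_geomTorsion_of_isCyclic`, `smul_mem_ker_inf_geomTorsion`),
i.e. a rational `ℓ`-isogeny kernel, contradicting irreducibility
(`Mazur1978.not_hasIrreducibleModPGaloisRep_iff_exists_natCard_eq`) — Silverman's dictionary
between `K`-rational cyclic isogenies and `Γ_K`-stable cyclic subgroups, read at the `ℓ`-torsion of
the kernel. [cite: SilvermanAEC2009, Prop. III.4.12 and Rem. III.4.13.2]
[cite: Mazur1978, Thm 1 (Introduction, pp. 129–130: rational N-isogenies)] -/
theorem not_dvd_degree_of_isCyclic_of_hasIrreducibleModPGaloisRep {W W' : WeierstrassCurve ℚ}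
    [W.IsElliptic] [W'.IsElliptic] {ℓ : ℕ} (hℓ : ℓ.Prime)
    (hirr : W.HasIrreducibleModPGaloisRep ℓ) (φ : Isogeny W W') (hφ : φ.IsCyclic) :
    ¬ ℓ ∣ φ.degree := by
  intro hd
  haveI : Fact ℓ.Prime := ⟨hℓ⟩
  haveI : NeZero (ℓ : ℚ) := ⟨Nat.cast_ne_zero.mpr hℓ.ne_zero⟩
  set G : AddSubgroup W.geomPoints := φ.toAddMonoidHom.ker ⊓ geomTorsion W (ℓ : ℤ) with hG
  have hGcard : Nat.card G = ℓ := φ.natCard_ker_inf_geomTorsion_of_isCyclic hφ hd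
  let H : AddSubgroup (geomTorsion W (ℓ : ℤ)) := G.addSubgroupOf (geomTorsion W (ℓ : ℤ))
  have hHcard : Nat.card H = ℓ := by
    have e : Nat.card H = Nat.card G :=
      Nat.card_congr (AddSubgroup.addSubgroupOfEquivOfLe (inf_le_right : G ≤ _)).toEquiv
    rw [e, hGcard]
  have hHstab : ∀ σ : Field.absoluteGaloisGroup ℚ, ∀ P ∈ H, σ • P ∈ H := by
    intro σ P hP
    rw [AddSubgroup.mem_addSubgroupOf] at hP ⊢
    exact φ.smul_mem_ker_inf_geomTorsion (ℓ : ℤ) σ hP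
  exact (Literature.NumberTheory.EllipticCurves.Mazur1978.not_hasIrreducibleModPGaloisRep_iff_exists_natCard_eq
    W ℓ).mpr ⟨H, hHstab, hHcard⟩ hirr

/-- **Lemma 6.8 EXACT at `ℓ`** (place form): for `ℚ`-isogenous elliptic `W ∼ W'` with `W[ℓ]`
irreducible and a place `v` of multiplicative reduction, `c_v(W) · b = c_v(W') · a` with `a, b`
PRIME TO `ℓ` — a cyclic isogeny `W → W'` exists (`IsIsogenous.exists_isCyclic`), its degree `n` is
prime to `ℓ` (above), and `c_v(W)/c_v(W') = a/b` with `ab ∣ n`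
(`exists_ordMinimalDiscriminant_mul_eq_mul_of_isCyclic`). [cite: PastenShimura2024, Lemma 6.8 p. 22] -/
theorem exists_ordMinimalDiscriminant_mul_eq_mul_coprime {W W' : WeierstrassCurve ℚ}
    [W.IsElliptic] [W'.IsElliptic] {ℓ : ℕ} (hℓ : ℓ.Prime) (hirr : W.HasIrreducibleModPGaloisRep ℓ)
    (hiso : W.IsIsogenous W') (v : IsDedekindDomain.HeightOneSpectrum ℤ)
    (hv : W.HasMultiplicativeReductionAt v) :
    ∃ a b : ℕ, 0 < a ∧ 0 < b ∧ ¬ ℓ ∣ a ∧ ¬ ℓ ∣ b ∧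
      W.ordMinimalDiscriminant v * b = W'.ordMinimalDiscriminant v * a := by
  obtain ⟨φ, hφ⟩ := hiso.exists_isCyclic
  have hv' : W'.HasMultiplicativeReductionAt v := hasMultiplicativeReductionAt_of_isIsogenous hiso v hv
  obtain ⟨a, b, ha, hb, hab, h⟩ :=
    exists_ordMinimalDiscriminant_mul_eq_mul_of_isCyclic φ.degree φ hφ rfl v hv hv'
  have hn := not_dvd_degree_of_isCyclic_of_hasIrreducibleModPGaloisRep hℓ hirr φ hφ
  exact ⟨a, b, ha, hb, fun h3 => hn ((dvd_mul_right ℓ b |>.trans (Nat.mul_dvd_mul_right h3 b)).trans hab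
      |> fun h => by simpa using h),
    fun h3 => hn ((Dvd.dvd.mul_left h3 a).trans hab), h⟩

/-- **Lemma 6.8 EXACT at `ℓ`, factorization form** (the idiom of Prop. 6.13 / `h613`): for
`W ∼ W'` with `W[ℓ]` irreducible and `p ∥ N_W`,
`v_ℓ(v_p(Δ_{W'})) = v_ℓ(v_p(Δ_W))`. Translation as in `lemma_6_8_factorization_form`
(`p ∥ N` ⇒ multiplicative at `v_p`, `ord_{v_p} Δ_min = v_p |Δ_min|`). [cite: PastenShimura2024, Lemma 6.8 p. 22 and §6.4] -/
theorem factorization_factorization_minimalDiscriminantNorm_eq_of_isIsogenous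
    {W W' : WeierstrassCurve ℚ} [W.IsElliptic] [W'.IsElliptic] {ℓ : ℕ} (hℓ : ℓ.Prime)
    (hirr : W.HasIrreducibleModPGaloisRep ℓ) (hiso : W.IsIsogenous W') {p : ℕ} (hp : p.Prime)
    (hpN : p ∣ W.conductorNorm ℤ) (hp2 : ¬ p ^ 2 ∣ W.conductorNorm ℤ) :
    ((W'.minimalDiscriminantNorm ℤ).factorization p).factorization ℓ =
      ((W.minimalDiscriminantNorm ℤ).factorization p).factorization ℓ := by
  set v : IsDedekindDomain.HeightOneSpectrum ℤ :=
    (Rat.HeightOneSpectrum.primesEquiv (R := ℤ)).symm ⟨p, hp⟩ with hv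
  have hgen : Rat.HeightOneSpectrum.natGenerator v = p :=
    Literature.NumberTheory.EllipticCurves.natGenerator_primesEquiv_symm hp
  have hN0 : W.conductorNorm ℤ ≠ 0 := fun h0 => hp2 (h0 ▸ dvd_zero _)
  have hfac : (W.conductorNorm ℤ).factorization p = 1 := by
    have h1 : 0 < (W.conductorNorm ℤ).factorization p := hp.factorization_pos_of_dvd hN0 hpN
    have h2 : ¬ 2 ≤ (W.conductorNorm ℤ).factorization p := fun h =>
      hp2 ((hp.pow_dvd_iff_le_factorization hN0).mpr h)
    omega
  have hf : W.conductorExponent v = 1 := by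
    have h := W.factorization_conductorNorm_holds v
    rw [hgen] at h
    rw [← h, hfac]
  have hmult : W.HasMultiplicativeReductionAt v :=
    (WeierstrassCurve.conductorExponent_eq_one_iff_holds v W).mp hf
  obtain ⟨a, b, ha, hb, ha3, hb3, hab⟩ :=
    exists_ordMinimalDiscriminant_mul_eq_mul_coprime hℓ hirr hiso v hmult
  have hΔ : (W.minimalDiscriminantNorm ℤ).factorization p = W.ordMinimalDiscriminant v := by
    have h := W.factorization_minimalDiscriminantNorm_holds v
    rwa [hgen] at h
  have hΔ' : (W'.minimalDiscriminantNorm ℤ).factorization p = W'.ordMinimalDiscriminant v := by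
    have h := W'.factorization_minimalDiscriminantNorm_holds v
    rwa [hgen] at h
  rw [hΔ, hΔ']
  -- `c · b = c' · a` with `ℓ ∤ a b`: compare `ℓ`-adic valuations
  have hc : 0 < W.ordMinimalDiscriminant v := by
    rw [← hΔ]; exact factorization_minimalDiscriminantNorm_pos_of_dvd W hp hpN
  have hc' : 0 < W'.ordMinimalDiscriminant v := by
    rcases Nat.eq_zero_or_pos (W'.ordMinimalDiscriminant v) with h0 | h0
    · rw [h0, zero_mul] at hab
      exact absurd hab (Nat.mul_ne_zero hc.ne' hb.ne')
    · exact h0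
  have key := congrArg (fun n => n.factorization ℓ) hab
  simp only [Nat.factorization_mul hc.ne' hb.ne', Nat.factorization_mul hc'.ne' ha.ne',
    Finsupp.add_apply, Nat.factorization_eq_zero_of_not_dvd ha3,
    Nat.factorization_eq_zero_of_not_dvd hb3, add_zero] at key
  exact key.symm


/-- Product form of the exact Lemma 6.8 (the shape of `h68` with `ℓ`-units in place of the height
bound): `v_p(Δ_{W'}) · b = a · v_p(Δ_W)` with `0 < a, b` and `ℓ ∤ a b`. [cite: PastenShimura2024, Lemma 6.8 p. 22 and §6.4] -/
theorem exists_factorization_minimalDiscriminantNorm_mul_eq_mul_coprime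
    {W W' : WeierstrassCurve ℚ} [W.IsElliptic] [W'.IsElliptic] {ℓ : ℕ} (hℓ : ℓ.Prime)
    (hirr : W.HasIrreducibleModPGaloisRep ℓ) (hiso : W.IsIsogenous W') {p : ℕ} (hp : p.Prime)
    (hpN : p ∣ W.conductorNorm ℤ) (hp2 : ¬ p ^ 2 ∣ W.conductorNorm ℤ) :
    ∃ a b : ℕ, 0 < a ∧ 0 < b ∧ ¬ ℓ ∣ a ∧ ¬ ℓ ∣ b ∧
      (W'.minimalDiscriminantNorm ℤ).factorization p * b =
        a * (W.minimalDiscriminantNorm ℤ).factorization p := by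
  set v : IsDedekindDomain.HeightOneSpectrum ℤ :=
    (Rat.HeightOneSpectrum.primesEquiv (R := ℤ)).symm ⟨p, hp⟩ with hv
  have hgen : Rat.HeightOneSpectrum.natGenerator v = p :=
    Literature.NumberTheory.EllipticCurves.natGenerator_primesEquiv_symm hp
  have hN0 : W.conductorNorm ℤ ≠ 0 := fun h0 => hp2 (h0 ▸ dvd_zero _)
  have hfac : (W.conductorNorm ℤ).factorization p = 1 := by
    have h1 : 0 < (W.conductorNorm ℤ).factorization p := hp.factorization_pos_of_dvd hN0 hpN
    have h2 : ¬ 2 ≤ (W.conductorNorm ℤ).factorization p := fun h =>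
      hp2 ((hp.pow_dvd_iff_le_factorization hN0).mpr h)
    omega
  have hf : W.conductorExponent v = 1 := by
    have h := W.factorization_conductorNorm_holds v
    rw [hgen] at h
    rw [← h, hfac]
  have hmult : W.HasMultiplicativeReductionAt v :=
    (WeierstrassCurve.conductorExponent_eq_one_iff_holds v W).mp hf
  obtain ⟨a, b, ha, hb, ha3, hb3, hab⟩ :=
    exists_ordMinimalDiscriminant_mul_eq_mul_coprime hℓ hirr hiso v hmult
  have hΔ : (W.minimalDiscriminantNorm ℤ).factorization p = W.ordMinimalDiscriminant v := by
    have h := W.factorization_minimalDiscriminantNorm_holds v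
    rwa [hgen] at h
  have hΔ' : (W'.minimalDiscriminantNorm ℤ).factorization p = W'.ordMinimalDiscriminant v := by
    have h := W'.factorization_minimalDiscriminantNorm_holds v
    rwa [hgen] at h
  refine ⟨b, a, hb, ha, hb3, ha3, ?_⟩
  rw [hΔ, hΔ', ← hab, mul_comm]

/-- Positivity transported along the class: `c_p(A) = v_p(Δ_A) > 0` for every `A ∼ W` and
`p ∥ N_W` (Pasten §6.4: for a prime `p` of multiplicative reduction `Φ_p(A)` is cyclic of order
`c_p(A) := v_p(Δ_A)`, a positive integer; here from the exact Lemma 6.8 identity and `c_p(W) > 0`).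
[cite: PastenShimura2024, §6.4 p. 22] -/
theorem factorization_minimalDiscriminantNorm_pos_of_isIsogenous
    {W W' : WeierstrassCurve ℚ} [W.IsElliptic] [W'.IsElliptic] {ℓ : ℕ} (hℓ : ℓ.Prime)
    (hirr : W.HasIrreducibleModPGaloisRep ℓ) (hiso : W.IsIsogenous W') {p : ℕ} (hp : p.Prime)
    (hpN : p ∣ W.conductorNorm ℤ) (hp2 : ¬ p ^ 2 ∣ W.conductorNorm ℤ) :
    0 < (W'.minimalDiscriminantNorm ℤ).factorization p := by
  obtain ⟨a, b, ha, hb, -, -, e⟩ :=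
    exists_factorization_minimalDiscriminantNorm_mul_eq_mul_coprime hℓ hirr hiso hp hpN hp2
  have hc := factorization_minimalDiscriminantNorm_pos_of_dvd W hp hpN
  rcases Nat.eq_zero_or_pos ((W'.minimalDiscriminantNorm ℤ).factorization p) with h0 | h0
  · rw [h0, zero_mul] at e
    exact absurd e.symm (Nat.mul_ne_zero ha.ne' hc.ne')
  · exact h0

/-! ## §2. Flat arithmetic: the EXACT switching identity (Lemma 6.15 at `ℓ` with no slack) -/

/-- **Exact switching (flat form).** From the two instances of Prop. 6.13
`δ₁ · i_p² · j_r² = δ · c_p(A₁) c_r(A₂)` and `δ₁ · i_r² · j_p² = δ · c_r(A₁) c_p(A₂)`, with the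
`c`'s of `A₁, A₂` having the SAME `ℓ`-adic valuation as those of `E` (exact Lemma 6.8) and
`v_ℓ(i_p) = v_ℓ(i_r) = 0`: `v_ℓ(j_p) = v_ℓ(j_r)`. All quantities positive. Compare
`factorization_le_of_two_identities` (the printed, slack-`α_S(ℓ)` form). [cite: PastenShimura2024, Lemma 6.15 p. 24 (proof, case p ≠ r)] -/
theorem factorization_eq_of_two_identities {δ₁ δ ip ir jp jr cp1 cr1 cp2 cr2 cpE crE ℓ : ℕ}
    (hδ₁ : 0 < δ₁) (hδ : 0 < δ) (hip : 0 < ip) (hir : 0 < ir) (hjp : 0 < jp) (hjr : 0 < jr)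
    (hcp1 : 0 < cp1) (hcr1 : 0 < cr1) (hcp2 : 0 < cp2) (hcr2 : 0 < cr2)
    (h1 : δ₁ * (ip ^ 2 * jr ^ 2) = δ * (cp1 * cr2))
    (h2 : δ₁ * (ir ^ 2 * jp ^ 2) = δ * (cr1 * cp2))
    (e1 : cp1.factorization ℓ = cpE.factorization ℓ) (e2 : cp2.factorization ℓ = cpE.factorization ℓ)
    (e3 : cr1.factorization ℓ = crE.factorization ℓ) (e4 : cr2.factorization ℓ = crE.factorization ℓ)
    (hipℓ : ip.factorization ℓ = 0) (hirℓ : ir.factorization ℓ = 0) :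
    jp.factorization ℓ = jr.factorization ℓ := by
  have key : ip ^ 2 * jr ^ 2 * (cr1 * cp2) = ir ^ 2 * jp ^ 2 * (cp1 * cr2) := by
    have h3 : δ₁ * δ * (ip ^ 2 * jr ^ 2 * (cr1 * cp2)) =
        δ₁ * δ * (ir ^ 2 * jp ^ 2 * (cp1 * cr2)) := by
      calc δ₁ * δ * (ip ^ 2 * jr ^ 2 * (cr1 * cp2))
          = (δ₁ * (ip ^ 2 * jr ^ 2)) * (δ * (cr1 * cp2)) := by ring
        _ = (δ * (cp1 * cr2)) * (δ₁ * (ir ^ 2 * jp ^ 2)) := by rw [h1, h2]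
        _ = δ₁ * δ * (ir ^ 2 * jp ^ 2 * (cp1 * cr2)) := by ring
    exact Nat.eq_of_mul_eq_mul_left (Nat.mul_pos hδ₁ hδ) h3
  have hv := congrArg (fun n : ℕ => n.factorization ℓ) key
  simp only [factorization_mul_apply (mul_ne_zero (pow_ne_zero 2 hip.ne') (pow_ne_zero 2 hjr.ne'))
      (mul_ne_zero hcr1.ne' hcp2.ne'),
    factorization_mul_apply (pow_ne_zero 2 hip.ne') (pow_ne_zero 2 hjr.ne'),
    factorization_mul_apply hcr1.ne' hcp2.ne',
    factorization_mul_apply (mul_ne_zero (pow_ne_zero 2 hir.ne') (pow_ne_zero 2 hjp.ne'))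
      (mul_ne_zero hcp1.ne' hcr2.ne'),
    factorization_mul_apply (pow_ne_zero 2 hir.ne') (pow_ne_zero 2 hjp.ne'),
    factorization_mul_apply hcp1.ne' hcr2.ne', factorization_pow_apply] at hv
  omega

/-! ## §3. The Ribet–Takahashi system at a prime `ℓ` with an irreducibility witness

Section variables, as in `ShimuraCurveRibetTakahashiCokernelProofs` §III (the printed inputs as
hypotheses on the component-group data `cI = i_·(D,M)`, `cJ = j_·(D,M)` of the class-minimal datum):
`h613` (Prop. 6.13 = Ribet–Takahashi 1997 Thm. 2), `hJc` (`j_p ∣ #Φ_p(A_{D,M}) = c_p(A_{D,M})`),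
`hEis` (Ribet's Eisenstein divisibility `i_p(D,M) ∣ r + 1 − a_r(A_{D,M})` for `p ∥ M`, `r ∤ N` —
the proof of Lemma 6.14), and the two inputs specific to the exact statement at `ℓ`: `h618`
(Lemma 6.18 p. 25 = Papikian–Rabinoff: `j_p(D,M) ∣ p − 1` for `p ∣ D`) and `hwit` (an
IRREDUCIBILITY WITNESS: if `W[ℓ]` is irreducible there are arbitrarily large primes `r` with
`a_r(W) ≢ r + 1 (mod ℓ)` — Chebotarev with Brauer–Nesbitt: otherwise `ρ̄^{ss} ≅ 1 ⊕ ω`; the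
`β = 1` case of the mechanism of Lemma 6.7, per curve). Nothing here is a declaration of the tree;
every statement below carries them as binders, exactly like `PastenShimura2024_thm_6_1_b'`. -/

section RTSystemExact

variable (cI cJ : ∀ {D M : ℕ} {X : ShimuraCurveData D M} {W' : WeierstrassCurve ℚ},
    ShimuraParametrizationData X W' → ℕ → ℕ)
  (hI : ∀ {D M : ℕ} {X : ShimuraCurveData D M} {W' : WeierstrassCurve ℚ}
    (P : ShimuraParametrizationData X W') (p : ℕ), 0 < cI P p)
  (hJ : ∀ {D M : ℕ} {X : ShimuraCurveData D M} {W' : WeierstrassCurve ℚ}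
    (P : ShimuraParametrizationData X W') (p : ℕ), 0 < cJ P p)
  (h613 : ∀ {N d M₁ D M p r : ℕ}, p.Prime → r.Prime → p ≠ r → D = d * (p * r) →
    M₁ = p * r * M → IsAdmissibleFactorization N D M →
    ∀ (X₁ : ShimuraCurveData d M₁) (X₂ : ShimuraCurveData D M)
      (W : WeierstrassCurve ℚ) [W.IsElliptic] [W.IsGloballyMinimal], W.conductorNorm ℤ = N →
    ∀ (W₁' : WeierstrassCurve ℚ) [W₁'.IsElliptic] (P₁ : ShimuraParametrizationData X₁ W₁'),
      P₁.IsMinimalFor W →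
    ∀ (W₂' : WeierstrassCurve ℚ) [W₂'.IsElliptic] (P₂ : ShimuraParametrizationData X₂ W₂'),
      P₂.IsMinimalFor W →
      P₁.deg * (cI P₁ p ^ 2 * cJ P₂ r ^ 2) =
        P₂.deg * ((W₁'.minimalDiscriminantNorm ℤ).factorization p *
          (W₂'.minimalDiscriminantNorm ℤ).factorization r))
  (hJc : ∀ {N D M : ℕ}, IsAdmissibleFactorization N D M →
    ∀ (X : ShimuraCurveData D M) (W : WeierstrassCurve ℚ) [W.IsElliptic] [W.IsGloballyMinimal],
      W.conductorNorm ℤ = N →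
    ∀ (W' : WeierstrassCurve ℚ) [W'.IsElliptic] (P : ShimuraParametrizationData X W'),
      P.IsMinimalFor W → ∀ p : ℕ, p.Prime → p ∣ D →
      cJ P p ∣ (W'.minimalDiscriminantNorm ℤ).factorization p)
  (hEis : ∀ {N D M : ℕ}, IsAdmissibleFactorization N D M →
    ∀ (X : ShimuraCurveData D M) (W : WeierstrassCurve ℚ) [W.IsElliptic] [W.IsGloballyMinimal],
      W.conductorNorm ℤ = N →
    ∀ (W' : WeierstrassCurve ℚ) [W'.IsElliptic] (P : ShimuraParametrizationData X W'),
      P.IsMinimalFor W → ∀ p : ℕ, p.Prime → p ∣ M → ¬ p ^ 2 ∣ M →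
      ∀ r : ℕ, r.Prime → ¬ r ∣ N → (cI P p : ℤ) ∣ (r + 1 : ℤ) - W'.LFunction r)
  (h618 : ∀ {N D M : ℕ}, IsAdmissibleFactorization N D M →
    ∀ (X : ShimuraCurveData D M) (W : WeierstrassCurve ℚ) [W.IsElliptic] [W.IsGloballyMinimal],
      W.conductorNorm ℤ = N →
    ∀ (W' : WeierstrassCurve ℚ) [W'.IsElliptic] (P : ShimuraParametrizationData X W'),
      P.IsMinimalFor W → ∀ p : ℕ, p.Prime → p ∣ D → cJ P p ∣ p - 1)
  {ℓ : ℕ}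
  (hwit : ∀ (W : WeierstrassCurve ℚ) [W.IsElliptic], W.HasIrreducibleModPGaloisRep ℓ →
    ∀ r₀ : ℕ, ∃ r : ℕ, r₀ < r ∧ r.Prime ∧ ¬ (ℓ : ℤ) ∣ (r + 1 : ℤ) - W.LFunction r)

include hEis hwit in
/-- **`i_p(D,M)` is an `ℓ`-unit when `W[ℓ]` is irreducible** (`p ∥ M`): the Eisenstein divisibility
`i_p ∣ r + 1 − a_r(A_{D,M}) = r + 1 − a_r(W)` (`hEis`; isogeny invariance of `a_r`, the tree's
`LFunction_eq_of_isIsogenous_holds`) at a witness prime `r > N` with `ℓ ∤ r + 1 − a_r(W)` (`hwit`).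
The per-curve `β = 1` instance of the proof of Lemma 6.14. [cite: PastenShimura2024, Lemma 6.14 p. 23 (proof)] -/
theorem not_dvd_cI_of_witness {N D M : ℕ} (hadm : IsAdmissibleFactorization N D M)
    (X : ShimuraCurveData D M) (W : WeierstrassCurve ℚ) [W.IsElliptic] [W.IsGloballyMinimal]
    (hWN : W.conductorNorm ℤ = N) (hirr : W.HasIrreducibleModPGaloisRep ℓ)
    (W' : WeierstrassCurve ℚ) [W'.IsElliptic] (P : ShimuraParametrizationData X W')
    (hPm : P.IsMinimalFor W) {p : ℕ} (hp : p.Prime) (hpM : p ∣ M) (hp2M : ¬ p ^ 2 ∣ M) :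
    ¬ ℓ ∣ cI P p := by
  obtain ⟨r, hrN, hr, hndvd⟩ := hwit W hirr N
  have hrN' : ¬ r ∣ N := fun h => absurd hrN (not_lt.mpr (Nat.le_of_dvd hadm.pos h))
  have hL : W'.LFunction = W.LFunction := (LFunction_eq_of_isIsogenous_holds W W' hPm.1).symm
  have hdvd := hEis hadm X W hWN W' P hPm p hp hpM hp2M r hr hrN'
  rw [hL] at hdvd
  intro h3
  exact hndvd ((Int.natCast_dvd_natCast.mpr h3).trans hdvd)

include hJc h618 in
/-- **`j_{q₀}(D,M)` is an `ℓ`-unit at a WITNESS prime `q₀ ∣ D`** — `q₀ ≢ 1 (mod ℓ)` (then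
`j_{q₀} ∣ q₀ − 1`, Lemma 6.18, is prime to `ℓ`) or `ℓ ∤ c_{q₀}(E)` (then `j_{q₀} ∣ c_{q₀}(A_{D,M})`,
`hJc`, and `v_ℓ c_{q₀}(A_{D,M}) = v_ℓ c_{q₀}(E)` by the exact Lemma 6.8). [cite: PastenShimura2024, Lemma 6.18 p. 25 and §6.6 p. 23] -/
theorem not_dvd_cJ_of_witness (hℓ : ℓ.Prime) {N D M : ℕ} (hadm : IsAdmissibleFactorization N D M)
    (X : ShimuraCurveData D M) (W : WeierstrassCurve ℚ) [W.IsElliptic] [W.IsGloballyMinimal]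
    (hWN : W.conductorNorm ℤ = N) (hirr : W.HasIrreducibleModPGaloisRep ℓ)
    (W' : WeierstrassCurve ℚ) [W'.IsElliptic] (P : ShimuraParametrizationData X W')
    (hPm : P.IsMinimalFor W) {q₀ : ℕ} (hq : q₀.Prime) (hqD : q₀ ∣ D)
    (hw : q₀ % ℓ ≠ 1 ∨ ¬ ℓ ∣ (W.minimalDiscriminantNorm ℤ).factorization q₀) :
    ¬ ℓ ∣ cJ P q₀ := by
  intro h3
  rcases hw with hmod | hc
  · have h31 : ℓ ∣ q₀ - 1 := h3.trans (h618 hadm X W hWN W' P hPm q₀ hq hqD)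
    obtain ⟨k, hk⟩ := h31
    have hq1 : q₀ = 1 + ℓ * k := by have := hq.two_le; omega
    apply hmod
    rw [hq1, Nat.add_mul_mod_self_left, Nat.one_mod_eq_one.mpr hℓ.one_lt.ne']
  · obtain ⟨hqN, hq2N⟩ := hadm.dvd_and_not_sq_dvd hq hqD
    rw [← hWN] at hqN hq2N
    have e := factorization_factorization_minimalDiscriminantNorm_eq_of_isIsogenous
      hℓ hirr hPm.1 hq hqN hq2N
    have hpos' := factorization_minimalDiscriminantNorm_pos_of_isIsogenous
      hℓ hirr hPm.1 hq hqN hq2N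
    have h3' : ℓ ∣ (W'.minimalDiscriminantNorm ℤ).factorization q₀ :=
      h3.trans (hJc hadm X W hWN W' P hPm q₀ hq hqD)
    have h1 : 0 < ((W'.minimalDiscriminantNorm ℤ).factorization q₀).factorization ℓ :=
      hℓ.factorization_pos_of_dvd hpos'.ne' h3'
    rw [e] at h1
    exact hc (Nat.dvd_of_factorization_pos (Nat.pos_iff_ne_zero.mp h1))

include hI hJ h613 hEis hwit in
/-- **Exact switching on `D` at `ℓ` (Lemma 6.15 with `α(ℓ) = 0`).** For a class-minimal
datum `P` of `W` at an admissible level `(D, M)`, `W[ℓ]` irreducible, and primes `p ≠ r` dividing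
`D`: `v_ℓ(j_p(D,M)) = v_ℓ(j_r(D,M))`. Proof as printed for `p ≠ r`: the two expressions of Prop. 6.13
for `δ_{d',prM}/δ_{D,M}` (`d' = D/(pr)`; the curve `X₀^{d'}(prM)` from
`nonempty_shimuraCurveData_holds`, a class-minimal datum from the Jacquet–Langlands fact `hP`), the
EXACT Lemma 6.8 (`W[ℓ]` irreducible: no slack) and `ℓ ∤ i_p(d',prM), i_r(d',prM)`
(`not_dvd_cI_of_witness`). [cite: PastenShimura2024, Lemma 6.15 p. 24, with Prop. 6.13 p. 23] -/
theorem factorization_cJ_eq_of_dvd_of_dvd (hℓ : ℓ.Prime) (hP : nonempty_shimuraParametrizationData)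
    {N D M : ℕ}
    (hadm : IsAdmissibleFactorization N D M) (X : ShimuraCurveData D M) (W : WeierstrassCurve ℚ)
    [W.IsElliptic] [W.IsGloballyMinimal] (hWN : W.conductorNorm ℤ = N)
    (hirr : W.HasIrreducibleModPGaloisRep ℓ) (W' : WeierstrassCurve ℚ) [W'.IsElliptic]
    (P : ShimuraParametrizationData X W') (hPm : P.IsMinimalFor W) {p r : ℕ} (hp : p.Prime)
    (hr : r.Prime) (hpr : p ≠ r) (hpD : p ∣ D) (hrD : r ∣ D) :
    (cJ P p).factorization ℓ = (cJ P r).factorization ℓ := by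
  obtain ⟨hpN, hp2N⟩ := hadm.dvd_and_not_sq_dvd hp hpD
  obtain ⟨hrN, hr2N⟩ := hadm.dvd_and_not_sq_dvd hr hrD
  rw [← hWN] at hpN hp2N hrN hr2N
  -- the level `(d', prM)`, a curve of that level and a class-minimal datum on it
  obtain ⟨hDd, hadm₁, -, -⟩ := hadm.erase_two_primes hp hr hpr hpD hrD
  set d' := D / (p * r) with hd'
  obtain ⟨X₁⟩ := nonempty_shimuraCurveData_holds hadm₁
  obtain ⟨W₁', hW₁', P₁, hP₁⟩ :=
    ShimuraParametrizationData.exists_isMinimalFor_of_nonempty (hP hadm₁ X₁ W hWN)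
  -- Prop. 6.13 for the pairs `(p, r)` and `(r, p)`
  have e1 := h613 hp hr hpr hDd rfl hadm X₁ X W hWN W₁' P₁ hP₁ W' P hPm
  have e2 := h613 hr hp (Ne.symm hpr) (by rw [hDd]; ring) (by ring) hadm X₁ X W hWN W₁' P₁ hP₁
    W' P hPm
  -- `ℓ ∤ i_p(d', prM), i_r(d', prM)` (`p, r ∥ prM`)
  obtain ⟨-, hp1, hp2⟩ := hadm.not_sq_dvd_mul_of_dvd hp hr hpr hpD
  obtain ⟨-, hr1, hr2⟩ := hadm.not_sq_dvd_mul_of_dvd hr hp (Ne.symm hpr) hrD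
  have hip := not_dvd_cI_of_witness cI hEis hwit hadm₁ X₁ W hWN hirr W₁' P₁ hP₁ hp hp1 hp2
  have hir := not_dvd_cI_of_witness cI hEis hwit hadm₁ X₁ W hWN hirr W₁' P₁ hP₁ hr
    (by rw [show p * r * M = r * p * M by ring]; exact hr1)
    (by rw [show p * r * M = r * p * M by ring]; exact hr2)
  -- exact Lemma 6.8 for the four `c`'s, and positivity
  have v1 := factorization_factorization_minimalDiscriminantNorm_eq_of_isIsogenous
    hℓ hirr hP₁.1 hp hpN hp2N
  have v2 := factorization_factorization_minimalDiscriminantNorm_eq_of_isIsogenous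
    hℓ hirr hPm.1 hp hpN hp2N
  have v3 := factorization_factorization_minimalDiscriminantNorm_eq_of_isIsogenous
    hℓ hirr hP₁.1 hr hrN hr2N
  have v4 := factorization_factorization_minimalDiscriminantNorm_eq_of_isIsogenous
    hℓ hirr hPm.1 hr hrN hr2N
  have c1 := factorization_minimalDiscriminantNorm_pos_of_isIsogenous hℓ hirr hP₁.1
    hp hpN hp2N
  have c2 := factorization_minimalDiscriminantNorm_pos_of_isIsogenous hℓ hirr hPm.1
    hp hpN hp2N
  have c3 := factorization_minimalDiscriminantNorm_pos_of_isIsogenous hℓ hirr hP₁.1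
    hr hrN hr2N
  have c4 := factorization_minimalDiscriminantNorm_pos_of_isIsogenous hℓ hirr hPm.1
    hr hrN hr2N
  exact factorization_eq_of_two_identities P₁.deg_pos P.deg_pos (hI P₁ p) (hI P₁ r) (hJ P p)
    (hJ P r) c1 c3 c2 c4 e1 e2 v1 v2 v3 v4 (Nat.factorization_eq_zero_of_not_dvd hip)
    (Nat.factorization_eq_zero_of_not_dvd hir)

/-! ## §4. The exact two-prime step and the telescoping at `ℓ` -/

include hI hJ h613 hEis hwit in
/-- **The two-prime step, EXACT at `ℓ`.** At an admissible level `(D, M)` with `W[ℓ]` irreducible,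
for primes `p ≠ r` of `D` such that `j_r(D,M)` is an `ℓ`-unit, a curve `X₁` of level `(d, prM)`,
`d = D/(pr)`, and class-minimal data `P₁`, `P`:
`δ_{d,prM} · b = a · δ_{D,M} · c_p(E) c_r(E)` with `ℓ ∤ a b` — Prop. 6.13 (`h613`), with
`ℓ ∤ i_p(d,prM)` (`not_dvd_cI_of_witness`, `p ∥ prM`) and the exact Lemma 6.8 twice.
[cite: PastenShimura2024, §6.9 p. 25 ((EqSequentially)), Prop. 6.13 p. 23] -/
theorem twoPrimeStep_coprime (hℓ : ℓ.Prime) {N D M d p r : ℕ} (hp : p.Prime) (hr : r.Prime)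
    (hpr : p ≠ r)
    (hDd : D = d * (p * r)) (hadm : IsAdmissibleFactorization N D M)
    (X₁ : ShimuraCurveData d (p * r * M)) (X₂ : ShimuraCurveData D M)
    (W : WeierstrassCurve ℚ) [W.IsElliptic] [W.IsGloballyMinimal] (hWN : W.conductorNorm ℤ = N)
    (hirr : W.HasIrreducibleModPGaloisRep ℓ)
    (W₁' : WeierstrassCurve ℚ) [W₁'.IsElliptic] (P₁ : ShimuraParametrizationData X₁ W₁')
    (hP₁ : P₁.IsMinimalFor W)
    (W₂' : WeierstrassCurve ℚ) [W₂'.IsElliptic] (P₂ : ShimuraParametrizationData X₂ W₂')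
    (hP₂ : P₂.IsMinimalFor W) (hjr : ¬ ℓ ∣ cJ P₂ r) :
    ∃ a b : ℕ, 0 < a ∧ 0 < b ∧ ¬ ℓ ∣ a ∧ ¬ ℓ ∣ b ∧
      P₁.deg * b = a * P₂.deg *
        ((W.minimalDiscriminantNorm ℤ).factorization p *
          (W.minimalDiscriminantNorm ℤ).factorization r) := by
  have hpD : p ∣ D := ⟨d * r, by rw [hDd]; ring⟩
  have hrD : r ∣ D := ⟨d * p, by rw [hDd]; ring⟩
  obtain ⟨hpN, hp2N⟩ := hadm.dvd_and_not_sq_dvd hp hpD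
  obtain ⟨hrN, hr2N⟩ := hadm.dvd_and_not_sq_dvd hr hrD
  rw [← hWN] at hpN hp2N hrN hr2N
  have hadm₁ : IsAdmissibleFactorization N d (p * r * M) := by
    have h := (hadm.erase_two_primes hp hr hpr hpD hrD).2.1
    have hd : D / (p * r) = d := by
      rw [hDd, Nat.mul_div_cancel _ (Nat.mul_pos hp.pos hr.pos)]
    rwa [hd] at h
  -- Prop. 6.13 and the unit `i_p(d, prM)`
  have e := h613 hp hr hpr hDd rfl hadm X₁ X₂ W hWN W₁' P₁ hP₁ W₂' P₂ hP₂
  obtain ⟨-, hp1, hp2⟩ := hadm.not_sq_dvd_mul_of_dvd hp hr hpr hpD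
  have hip := not_dvd_cI_of_witness cI hEis hwit hadm₁ X₁ W hWN hirr W₁' P₁ hP₁ hp hp1 hp2
  -- exact Lemma 6.8 for `c_p(W₁')` and `c_r(W₂')`
  obtain ⟨a₁, b₁, ha₁, hb₁, ha₁3, hb₁3, e₁⟩ :=
    exists_factorization_minimalDiscriminantNorm_mul_eq_mul_coprime hℓ hirr hP₁.1 hp
      hpN hp2N
  obtain ⟨a₂, b₂, ha₂, hb₂, ha₂3, hb₂3, e₂⟩ :=
    exists_factorization_minimalDiscriminantNorm_mul_eq_mul_coprime hℓ hirr hP₂.1 hr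
      hrN hr2N
  refine ⟨a₁ * a₂, cI P₁ p ^ 2 * cJ P₂ r ^ 2 * (b₁ * b₂), Nat.mul_pos ha₁ ha₂,
    Nat.mul_pos (Nat.mul_pos (pow_pos (hI P₁ p) 2) (pow_pos (hJ P₂ r) 2)) (Nat.mul_pos hb₁ hb₂),
    ?_, ?_, ?_⟩
  · exact Nat.Prime.not_dvd_mul hℓ ha₁3 ha₂3
  · refine Nat.Prime.not_dvd_mul hℓ
      (Nat.Prime.not_dvd_mul hℓ ?_ ?_) (Nat.Prime.not_dvd_mul hℓ hb₁3 hb₂3)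
    · exact fun h => hip (hℓ.dvd_of_dvd_pow h)
    · exact fun h => hjr (hℓ.dvd_of_dvd_pow h)
  · set cp1 := (W₁'.minimalDiscriminantNorm ℤ).factorization p
    set cr2 := (W₂'.minimalDiscriminantNorm ℤ).factorization r
    set cp := (W.minimalDiscriminantNorm ℤ).factorization p
    set cr := (W.minimalDiscriminantNorm ℤ).factorization r
    calc P₁.deg * (cI P₁ p ^ 2 * cJ P₂ r ^ 2 * (b₁ * b₂))
        = (P₁.deg * (cI P₁ p ^ 2 * cJ P₂ r ^ 2)) * (b₁ * b₂) := by ring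
      _ = P₂.deg * (cp1 * cr2) * (b₁ * b₂) := by rw [e]
      _ = P₂.deg * ((cp1 * b₁) * (cr2 * b₂)) := by ring
      _ = P₂.deg * ((a₁ * cp) * (a₂ * cr)) := by rw [e₁, e₂]
      _ = a₁ * a₂ * P₂.deg * (cp * cr) := by ring

include hI hJ h613 hJc hEis h618 hwit in
/-- **The telescoping of §6.9, EXACT at `ℓ` along a witness prime.** Under the `ℓ`-adic `D = 1`
bridge `h0'` (the two renderings of `δ_{1,N}` — the class-minimal Shimura datum on a
`ShimuraCurveData 1 N` and the minimal classical datum carrying the newform — differ by an `ℓ`-unit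
factor) and the section hypotheses: for every admissible `(D, M)` with `ω(D) = 2n` such that
`D = 1` or `D` has a WITNESS prime `q₀` (`q₀ ≢ 1 (mod ℓ)` or `ℓ ∤ v_{q₀}(Δ_W)`), every `W` of conductor `N` with
`W[ℓ]` irreducible, class-minimal `D₁` (classical) and `P` (Shimura): `δ_{1,N} · b = a · δ_{D,M} ·
∏_{p ∣ D} v_p(Δ_W)` with `ℓ ∤ a b` (at `ℓ = 3`: the summit-side `RTGammaThreeUnitAt W D₁ P`). Induction on `n`, removing two
primes of `D` at a time and KEEPING `q₀` IN `D` UNTIL THE LAST PAIR: at `ω(D) ≥ 4` the removed pair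
avoids `q₀` and `ℓ ∤ j_r(D,M)` by exact switching to `j_{q₀}` (`factorization_cJ_eq_of_dvd_of_dvd`,
`not_dvd_cJ_of_witness`); at `ω(D) = 2` the pair is `(p, q₀)` itself.
[cite: PastenShimura2024, §6.9 p. 25 (proof of Thm. 6.1, telescoping) and Lemmas 6.15, 6.18] -/
theorem modularDegree_mul_eq_mul_coprime_of_witness (hℓ : ℓ.Prime)
    (hP : nonempty_shimuraParametrizationData)
    (h0' : ∀ {N : ℕ} [NeZero N] (X : ShimuraCurveData 1 N) (W : WeierstrassCurve ℚ) [W.IsElliptic]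
      [W.IsGloballyMinimal], W.conductorNorm ℤ = N → W.HasIrreducibleModPGaloisRep ℓ →
      ∀ (W₁ : WeierstrassCurve ℚ) [W₁.IsElliptic] (D₁ : ModularParametrizationData W₁ N),
        IsNewformOf W D₁.f →
        (∀ (W₂ : WeierstrassCurve ℚ) [W₂.IsElliptic] (D₂ : ModularParametrizationData W₂ N),
            D₂.f = D₁.f → D₁.modularDegree ≤ D₂.modularDegree) →
      ∀ (W' : WeierstrassCurve ℚ) [W'.IsElliptic] (P : ShimuraParametrizationData X W'),
        P.IsMinimalFor W → ∃ a b : ℕ, 0 < a ∧ 0 < b ∧ ¬ ℓ ∣ a ∧ ¬ ℓ ∣ b ∧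
          D₁.modularDegree * b = a * P.deg)
    (n : ℕ) : ∀ {N D M : ℕ} [NeZero N], IsAdmissibleFactorization N D M →
      D.primeFactors.card = 2 * n →
    ∀ (X : ShimuraCurveData D M) (W : WeierstrassCurve ℚ) [W.IsElliptic] [W.IsGloballyMinimal],
      W.conductorNorm ℤ = N → W.HasIrreducibleModPGaloisRep ℓ →
      (D = 1 ∨ ∃ q₀ ∈ D.primeFactors,
        (q₀ % ℓ ≠ 1 ∨ ¬ ℓ ∣ (W.minimalDiscriminantNorm ℤ).factorization q₀)) →
    ∀ (W₁ : WeierstrassCurve ℚ) [W₁.IsElliptic] (D₁ : ModularParametrizationData W₁ N),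
      IsNewformOf W D₁.f →
      (∀ (W₂ : WeierstrassCurve ℚ) [W₂.IsElliptic] (D₂ : ModularParametrizationData W₂ N),
          D₂.f = D₁.f → D₁.modularDegree ≤ D₂.modularDegree) →
    ∀ (W' : WeierstrassCurve ℚ) [W'.IsElliptic] (P : ShimuraParametrizationData X W'),
      P.IsMinimalFor W →
      ∃ a b : ℕ, 0 < a ∧ 0 < b ∧ ¬ ℓ ∣ a ∧ ¬ ℓ ∣ b ∧
        D₁.modularDegree * b =
          a * P.deg * ∏ p ∈ D.primeFactors, (W.minimalDiscriminantNorm ℤ).factorization p := by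
  induction n with
  | zero =>
    intro N D M _ hadm hn X W _ _ hWN hirr _ W₁ _ D₁ hf hmin W' _ P hPmin
    -- `D = 1`, `M = N`: the `ℓ`-adic `D = 1` bridge
    have hD : D = 1 := by
      have h1 := Nat.primeFactors_eq_empty.mp (Finset.card_eq_zero.mp (by simpa using hn))
      exact h1.resolve_left hadm.squarefree.ne_zero
    subst hD
    obtain rfl : M = N := by simpa using hadm.mul_eq
    obtain ⟨a, b, ha, hb, ha3, hb3, e⟩ := h0' X W hWN hirr W₁ D₁ hf hmin W' P hPmin
    exact ⟨a, b, ha, hb, ha3, hb3, by simp [e]⟩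
  | succ n ih =>
    intro N D M _ hadm hn X W _ _ hWN hirr hwD W₁ _ D₁ hf hmin W' _ P hPmin
    -- `D ≠ 1`: a witness prime `q₀ ∣ D`
    have hD1 : D ≠ 1 := by
      rintro rfl
      simp at hn
    obtain ⟨q₀, hq₀mem, hq₀w⟩ := hwD.resolve_left hD1
    have hq₀ : q₀.Prime := Nat.prime_of_mem_primeFactors hq₀mem
    have hq₀D : q₀ ∣ D := Nat.dvd_of_mem_primeFactors hq₀mem
    -- the pair `(p, r)` to remove: `r = q₀` if `ω(D) = 2`, else `p, r ≠ q₀`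
    obtain ⟨p, r, hp, hr, hpr, hrq, hstay⟩ : ∃ p r, p ∈ D.primeFactors ∧ r ∈ D.primeFactors ∧
        p ≠ r ∧ (cJ P r).factorization ℓ = 0 ∧
        (D / (p * r) = 1 ∨ q₀ ∈ (D / (p * r)).primeFactors) := by
      have hjq : ¬ ℓ ∣ cJ P q₀ :=
        not_dvd_cJ_of_witness cJ hJc h618 hℓ hadm X W hWN hirr W' P hPmin hq₀ hq₀D hq₀w
      by_cases hn0 : n = 0
      · -- `ω(D) = 2`: `D = p q₀`
        subst hn0
        obtain ⟨p, hp⟩ : (D.primeFactors.erase q₀).Nonempty :=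
          Finset.card_pos.mp (by rw [Finset.card_erase_of_mem hq₀mem]; omega)
        obtain ⟨hpq, hp⟩ := Finset.mem_erase.mp hp
        have hpp : p.Prime := Nat.prime_of_mem_primeFactors hp
        obtain ⟨-, hadm₁, hdisj, hpf⟩ :=
          hadm.erase_two_primes hpp hq₀ hpq (Nat.dvd_of_mem_primeFactors hp) hq₀D
        refine ⟨p, q₀, hp, hq₀mem, hpq, Nat.factorization_eq_zero_of_not_dvd hjq, Or.inl ?_⟩
        have hcard : (D / (p * q₀)).primeFactors.card = 0 := by
          have h := congrArg Finset.card hpf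
          rw [Finset.card_union_of_disjoint hdisj, Finset.card_pair hpq] at h
          omega
        have h1 := Nat.primeFactors_eq_empty.mp (Finset.card_eq_zero.mp hcard)
        exact h1.resolve_left hadm₁.squarefree.ne_zero
      · -- `ω(D) ≥ 4`: two primes of `D` other than `q₀`; `ℓ ∤ j_r` by exact switching
        obtain ⟨p, hp⟩ : (D.primeFactors.erase q₀).Nonempty :=
          Finset.card_pos.mp (by rw [Finset.card_erase_of_mem hq₀mem]; omega)
        obtain ⟨r, hr⟩ : ((D.primeFactors.erase q₀).erase p).Nonempty :=
          Finset.card_pos.mp (by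
            rw [Finset.card_erase_of_mem hp, Finset.card_erase_of_mem hq₀mem]; omega)
        obtain ⟨hrp, hr⟩ := Finset.mem_erase.mp hr
        obtain ⟨hrq, hr⟩ := Finset.mem_erase.mp hr
        obtain ⟨hpq, hp⟩ := Finset.mem_erase.mp hp
        have hpp : p.Prime := Nat.prime_of_mem_primeFactors hp
        have hrr : r.Prime := Nat.prime_of_mem_primeFactors hr
        have hsw := factorization_cJ_eq_of_dvd_of_dvd cI cJ hI hJ h613 hEis hwit hℓ hP hadm X W hWN
          hirr W' P hPmin hrr hq₀ hrq (Nat.dvd_of_mem_primeFactors hr) hq₀D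
        obtain ⟨-, hadm₁, hdisj, hpf⟩ :=
          hadm.erase_two_primes hpp hrr (Ne.symm hrp) (Nat.dvd_of_mem_primeFactors hp)
            (Nat.dvd_of_mem_primeFactors hr)
        refine ⟨p, r, hp, hr, Ne.symm hrp, ?_, Or.inr ?_⟩
        · rw [hsw]; exact Nat.factorization_eq_zero_of_not_dvd hjq
        · have h := hpf ▸ hq₀mem
          rcases Finset.mem_union.mp h with h | h
          · exact h
          · simp only [Finset.mem_insert, Finset.mem_singleton] at h
            rcases h with h | h
            · exact absurd h.symm hpq
            · exact absurd h.symm hrq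
    have hpp : p.Prime := Nat.prime_of_mem_primeFactors hp
    have hrr : r.Prime := Nat.prime_of_mem_primeFactors hr
    obtain ⟨hDd, hadm₁, hdisj, hpf⟩ :=
      hadm.erase_two_primes hpp hrr hpr (Nat.dvd_of_mem_primeFactors hp)
        (Nat.dvd_of_mem_primeFactors hr)
    set d := D / (p * r) with hd
    have hcard : d.primeFactors.card = 2 * n := by
      have h := congrArg Finset.card hpf
      rw [Finset.card_union_of_disjoint hdisj, Finset.card_pair hpr] at h
      omega
    -- the curve `X₀^d(prM)` and a datum realising `δ_{d,prM}`; the witness passes to `d`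
    obtain ⟨X₁⟩ := nonempty_shimuraCurveData_holds hadm₁
    obtain ⟨W₁', hW₁', P₁, hP₁min⟩ :=
      ShimuraParametrizationData.exists_isMinimalFor_of_nonempty (hP hadm₁ X₁ W hWN)
    have hwd : d = 1 ∨ ∃ q ∈ d.primeFactors,
        (q % ℓ ≠ 1 ∨ ¬ ℓ ∣ (W.minimalDiscriminantNorm ℤ).factorization q) :=
      hstay.imp id fun h => ⟨q₀, h, hq₀w⟩
    -- induction hypothesis at level `(d, prM)` and the exact two-prime step
    obtain ⟨a₁, b₁, ha₁, hb₁, ha₁3, hb₁3, h₁⟩ :=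
      ih hadm₁ hcard X₁ W hWN hirr hwd W₁ D₁ hf hmin W₁' P₁ hP₁min
    have hjr : ¬ ℓ ∣ cJ P r := fun h => by
      have := hℓ.factorization_pos_of_dvd (hJ P r).ne' h
      omega
    obtain ⟨a₂, b₂, ha₂, hb₂, ha₂3, hb₂3, h₂⟩ :=
      twoPrimeStep_coprime cI cJ hI hJ h613 hEis hwit hℓ hpp hrr hpr hDd hadm X₁ X W
        hWN hirr W₁' P₁ hP₁min W' P hPmin hjr
    refine ⟨a₁ * a₂, b₁ * b₂, Nat.mul_pos ha₁ ha₂, Nat.mul_pos hb₁ hb₂,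
      Nat.Prime.not_dvd_mul hℓ ha₁3 ha₂3,
      Nat.Prime.not_dvd_mul hℓ hb₁3 hb₂3, ?_⟩
    rw [hpf, Finset.prod_union hdisj, Finset.prod_pair hpr]
    set V := ∏ q ∈ d.primeFactors, (W.minimalDiscriminantNorm ℤ).factorization q
    set vp := (W.minimalDiscriminantNorm ℤ).factorization p
    set vr := (W.minimalDiscriminantNorm ℤ).factorization r
    calc D₁.modularDegree * (b₁ * b₂) = D₁.modularDegree * b₁ * b₂ := by ring
      _ = a₁ * P₁.deg * V * b₂ := by rw [h₁]
      _ = a₁ * V * (P₁.deg * b₂) := by ring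
      _ = a₁ * V * (a₂ * P.deg * (vp * vr)) := by rw [h₂]
      _ = a₁ * a₂ * P.deg * (V * (vp * vr)) := by ring

end RTSystemExact

end Literature.NumberTheory.Automorphic

end
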